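import Mathlib

/-!
# Sketch — crux-ideate `stmt-Langlands-8927` (β′ = `EigenIntegralOverconvergentIsClassical`), ideator 2

First-lemma signatures of the idea cards `shift-tower-rigidity` and `sen-triage-theta-presentation`.
Statements only (sorried); they must elaborate. All constants are Mathlib's.
-/

open scoped BigOperators
open NumberField

namespace Summit.Langlands.Langlands.Cruxes.EigenIntegralOverconvergentIsClassical.Sketch

/-- Card `shift-tower-rigidity`, first lemma (tower factorisation): exact `T_ℓ`-eigenness for all
primes `ℓ ∤ Np` together with `b 1 = 1` forces `b (n * m) = b n * b m` whenever `n` is coprime to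
`N p` and `m` is supported on the primes of `N p`. Hence `g = Σ_{m | (Np)^∞} a_m · V_m(g^♭)` with
`g^♭` the `Np`-depleted series: the exact tame eigenspace is a space of coefficient sequences on which
`U_p` acts as the left shift. Pure algebra (strong induction on `n`). -/
theorem towerFactorisation (N p : ℕ) (k : ℤ) (ψ : DirichletCharacter ℂ N) (b : ℕ → ℂ)
    (h1 : b 1 = 1)
    (hT : ∀ ℓ n : ℕ, ℓ.Prime → ¬ ℓ ∣ N * p → 0 < n →
      b (ℓ * n) + (if ℓ ∣ n then ψ ℓ * (ℓ : ℂ) ^ (k - 1) * b (n / ℓ) else 0) = b ℓ * b n) :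
    ∀ m n : ℕ, 0 < m → 0 < n → Nat.Coprime n (N * p) →
      (∀ q : ℕ, q.Prime → q ∣ m → q ∣ N * p) → b (n * m) = b n * b m := by
  sorry

/-- Card `shift-tower-rigidity`, second lemma (Liouville / product formula): a non-zero algebraic
integer of a number field `E` divisible by `p ^ m` has a complex conjugate of absolute value at least
`p ^ m`. Applied to `c = a (p ^ j)`: the divisibility `v_p(a_{p^j}) ≥ κ p^j` that Frobenius
contraction forces on a quasi-nilpotent overconvergent tower contradicts radius `≥ 1` at some
embedding (which only allows `log ‖σ (a_{p^j})‖ = o(p^j)`). -/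
theorem exists_embedding_norm_ge_of_prime_pow_dvd (E : Type) [Field E] [NumberField E]
    (p : ℕ) (hp : p.Prime) (m : ℕ) (c : 𝓞 E) (hc : c ≠ 0) (hdvd : ((p : 𝓞 E) ^ m) ∣ c) :
    ∃ σ : E →+* ℂ, (p : ℝ) ^ m ≤ ‖σ (c : E)‖ := by
  sorry

/-- Both cards, lemma zero (weight floor): the hypotheses of β′ force `1 ≤ k`. From the Hecke
relation at `n = ℓ` for one prime `ℓ ∤ Np`: `ψ(ℓ) ℓ^(k-1) = a(ℓ)^2 - a(ℓ^2)` is the image under `σ₀`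
of an algebraic integer, and `ψ ℓ` is a root of unity, impossible when `k ≤ 0`. -/
theorem one_le_weight (N p : ℕ) [NeZero N] (hp : p.Prime) (hp5 : 5 ≤ p) (hN : ¬ p ∣ N) (k : ℤ)
    (E : Type) [Field E] [NumberField E] (σ₀ : E →+* ℂ) (a : ℕ → E) (ψ : DirichletCharacter ℂ N)
    (h1 : a 1 = 1) (hint : ∀ n, IsIntegral ℤ (a n))
    (hT : ∀ ℓ n : ℕ, ℓ.Prime → ¬ ℓ ∣ N * p → 0 < n →
      σ₀ (a (ℓ * n)) + (if ℓ ∣ n then ψ ℓ * (ℓ : ℂ) ^ (k - 1) * σ₀ (a (n / ℓ)) else 0)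
        = σ₀ (a ℓ) * σ₀ (a n)) :
    1 ≤ k := by
  sorry

/-- Card `sen-triage-theta-presentation`, first q-expansion lemma (θ-shadow): an exact `U_p`-eigen
sequence `b (p * n) = lam * b n` whose eigenvalue has slope `≥ k - 1` along `ι⁻¹` (forced, for a
NON-classical finite-slope eigensystem of weight `k ≥ 2`, by Coleman's classicality theorem) is
`p`-adically a `θ^{k-1}`-image: `‖ι⁻¹ b (p^j n)‖ ≤ p^{-(k-1) j} ‖ι⁻¹ b n‖`, i.e. `b = θ^{k-1} h` with
`h` of weight `2 - k` having `ι⁻¹`-bounded coefficients along `p`-power towers. -/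
theorem theta_shadow (p : ℕ) [Fact p.Prime] (k : ℕ) (ι : PadicAlgCl p ≃+* ℂ) (b : ℕ → ℂ) (lam : ℂ)
    (hU : ∀ n, b (p * n) = lam * b n) (hslope : ‖ι.symm lam‖ ≤ (p : ℝ) ^ (-(k : ℤ) + 1)) :
    ∀ j n : ℕ, ‖ι.symm (b (p ^ j * n))‖ ≤ ((p : ℝ) ^ (-(k : ℤ) + 1)) ^ j * ‖ι.symm (b n)‖ := by
  sorry

end Summit.Langlands.Langlands.Cruxes.EigenIntegralOverconvergentIsClassical.Sketch
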